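import Summits.FinalStateConjecture.FinalStateConjecture.Theorems.BartnikGapSettlingBondiBartnikRigiditySlabCauchyRigidityLensCauchy
import Literature.Geometry.Lorentzian.CauchyHypersurfaceGlobalHyperbolicity
import Literature.Geometry.Lorentzian.CausalFutureCompactSet
import Literature.Geometry.Lorentzian.CausalityPushUp
import Summits.FinalStateConjecture.FinalStateConjecture.Theorems.ZeroEnergyKerrOrBombZeroEnergyRigidityStubFuturePresentationOpens
import HarnessLib

/-!
# K2b-2 `SlabFrontier`, brick 2: the big lenses of the Kerr star chart are globally hyperbolic — line
# `direct-method-on-the-cone` (crux `BondiBartnikRigidity`, stmt-FinalStateConjecture-10807)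

For every `A` the LENS `U_A = {3A − 2r − 3t* > 0} ∩ {3A − 2r + 3t* > 0} ∩ {2t* + r − M > 0}` of the
ingoing Kerr–Schild star chart `Kerr.region a M = {r > M}` (`0 < M`, `|a| < M`) has the slice
`{t* = 0} ∩ U_A = {t* = 0, M < r < 3A/2}` as a Cauchy hypersurface (`lens_cauchy_chart`, chart form;
`isCauchyHypersurface_lens`, packaged for the open sub-spacetime), hence is globally hyperbolic
(`isGloballyHyperbolic_lens`, O'Neill's Cor. 14.39 in the tree: `IsCauchyHypersurface.isGloballyHyperbolic`)
and the causal future IN THE LENS of a compact subset is closed (`isClosed_causalFuture_lens`,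
`IsGloballyHyperbolic.isClosed_causalFuture_of_isCompact`).  For `A = 2M` the lens is the slab lens
`F1Route.lensK` of F1' and the proof is that of `F1Route.slab_cauchy_chart` verbatim with `6M ↦ 3A`:
ORDER THEORY of the three clocks `t* ± (2/3) r`, `t* + r/2` (strictly increasing along future timelike
curves, `F1Route.strictMonoOn_clock`), the escape trichotomy with the Minkowski endpoint lemmas, and the
hole clock (`CollarCauchy.strictAntiOn_radius`) excluding the chart edge `r = M` pastward.  The lens is
handed over as an abstract open set `U` with its membership predicate (no definition is introduced).
Also here (`SubCausal`): an ambient causal segment inside an open sub-spacetime `U` is a causal segment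
of `U` (`mem_causalFuture_restrict_of_subset`, on top of the sub-spacetime bookkeeping of
`…ZeroEnergyRigidityStubFuturePresentationOpens`), and `interior J⁺(S) ⊆ I⁺(S)` on manifolds without
boundary (`interior_causalFuture_subset`, from push-up).

References: O'Neill 1983, Ch. 14, Def. 14.28, Lemma 14.22, Cor. 14.39 [ONeill1983]; Hawking–Ellis 1973,
Prop. 6.6.1, 6.6.3 [HawkingEllis1973CUP]; Dafermos–Rodnianski arXiv:0811.0354 §5.1 [DafermosRodnianski2008].
No definitions, no named facts.
-/

noncomputable section

-- D-0017: single-problem summit, `Summit.<S>.<S>.…` by design (cf. lakefile `weak.linter.dupNamespace`).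
set_option linter.dupNamespace false

open Set Filter Function Topology TopologicalSpace
open Literature.Geometry.Lorentzian
open scoped Manifold ContDiff Topology
open Summit.FinalStateConjecture.FinalStateConjecture.Theorems.SwallowTheDatum.KerrShieldedSettles.CollarCauchy
  (minkowski_curve hasDerivAt_radius_comp strictAntiOn_radius)
open Summit.FinalStateConjecture.FinalStateConjecture.Theorems.ZeroEnergyRigidity.GlobalHorizonKillingField.FuturePresentation
  (exists_curve_lift isFutureCausalCurveOn_congr_of_eventuallyEq isFutureCausalCurveOn_restrict_iff)

namespace Summit.FinalStateConjecture.FinalStateConjecture.Theorems.BondiBartnikRigidity.DirectMethod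

namespace SubCausal

/-! ### Generic causal lemmas: causal segments inside an open sub-spacetime, `interior J⁺ ⊆ I⁺` -/

section Generic

variable {E : Type*} [NormedAddCommGroup E] [NormedSpace ℝ E] {H : Type*} [TopologicalSpace H]
  {I : ModelWithCorners ℝ E H} {n : ℕ∞ω} {X : Type*} [TopologicalSpace X] [ChartedSpace H X]
  [IsManifold I ∞ X] {g : LorentzianMetric I n X} {τ : TimeOrientation g}

variable (g τ) (hres : PseudoRiemannianMetric.contMDiff_restrict (I := I) (n := n) (M := X))
  (hτ : τ.contMDiff_restrict) (U : Opens X)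

/-- **An ambient causal segment lying in `U` is a causal segment of the sub-spacetime `U`**: if a future
causal curve of `X` on `[a, b]` from a point of `ι K` stays in the open set `U`, its endpoint is in
`ι(J⁺_U(K))`. O'Neill 1983, Ch. 14, p. 402; Hawking–Ellis 1973, §6.5. [cite: ONeill1983, Ch. 14, p. 402] -/
theorem mem_causalFuture_restrict_of_subset {K : Set U} {γ : ℝ → X} {a b : ℝ} (hab : a < b)
    (hγ : g.IsFutureCausalCurveOn τ γ (Icc a b)) (hK : γ a ∈ Subtype.val '' K)
    (hU : ∀ t ∈ Icc a b, γ t ∈ U) :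
    ∃ h : γ b ∈ U, (⟨γ b, h⟩ : U) ∈ (g.restrict hres U).causalFuture (τ.restrict hres hτ U) K := by
  obtain ⟨p, hpK, hpa⟩ := hK
  -- lift `γ` into `U` (equal to `γ` on `[a, b]`): a causal curve of the sub-spacetime
  obtain ⟨δ, hδval, hδev⟩ := exists_curve_lift U hab.le (fun t ht ↦ (hγ t ht).1.continuousAt) hU
  refine ⟨hU b (right_mem_Icc.2 hab.le), Or.inr ⟨p, hpK, δ, a, b, hab,
    (isFutureCausalCurveOn_restrict_iff g τ hres hτ U).2
      (isFutureCausalCurveOn_congr_of_eventuallyEq hγ hδev), ?_, ?_⟩⟩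
  · exact Subtype.ext ((hδval a (left_mem_Icc.2 hab.le)).trans hpa.symm)
  · exact Subtype.ext (hδval b (right_mem_Icc.2 hab.le))

variable {g τ}

/-- **`interior J⁺(S) ⊆ I⁺(S)`** on a manifold without boundary (finite dimension, `Cⁿ`, `n ≥ 1`):
a point `x` of the interior has a point `x⁻ ≪ x` inside the interior
(`exists_mem_nhds_mem_chronologicalFuture`), `x⁻ ∈ J⁺(p)` for some `p ∈ S`, and push-up
(`mem_chronologicalFuture_of_mem_causalFuture`) gives `x ∈ I⁺(p)`. O'Neill 1983, Ch. 14, Lemma 14.6 (1)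
(`int J⁺(A) = I⁺(A)`). [cite: ONeill1983, Ch. 14, Lemma 14.6] -/
theorem interior_causalFuture_subset [BoundarylessManifold I X] [FiniteDimensional ℝ E]
    (hn : 1 ≤ n) (S : Set X) : interior (g.causalFuture τ S) ⊆ g.chronologicalFuture τ S := by
  haveI : CompleteSpace E := FiniteDimensional.complete ℝ E
  intro x hx
  obtain ⟨x', hx', hxx'⟩ := LorentzianMetric.exists_mem_nhds_mem_chronologicalFuture (g := g) (τ := τ)
    hn (isOpen_interior.mem_nhds hx)
  have hx'J : x' ∈ g.causalFuture τ S := interior_subset hx'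
  rw [LorentzianMetric.causalFuture_eq_biUnion] at hx'J
  simp only [mem_iUnion, exists_prop] at hx'J
  obtain ⟨p, hpS, hx'p⟩ := hx'J
  exact LorentzianMetric.chronologicalFuture_mono (singleton_subset_iff.2 hpS)
    (LorentzianMetric.mem_chronologicalFuture_of_mem_causalFuture hn hx'p hxx')

end Generic

end SubCausal

namespace KerrLens

open F1Route (strictMonoOn_clock strictMonoOn_time' rMinus_lt_self self_lt_rPlus)

variable [Kerr.Facts]

/-- **The slice `{t* = 0}` is met exactly once by every future timelike curve of the chart lying in
the lens `U_A` and without future/past endpoint in `U_A`** (chart form; `F1Route.slab_cauchy_chart` is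
the case `A = 2M`).  Uniqueness by monotonicity of `t*`; existence by the escape trichotomy: below the
slice `t* < 0` is bounded above, so the coordinate curve has a future endpoint `q ∈ E4`, which the
increasing clocks `t* − (2/3) r`, `t* + r/2` put in `U_A`; above the slice the past endpoint `q` is put in
`U_A` by the clock `t* + (2/3) r` and the hole clock (`r(q) = M` is unreachable pastward).
[cite: ONeill1983, Ch. 14, Def. 14.28] -/
theorem lens_cauchy_chart {M a : ℝ} (A : ℝ) (hM0 : 0 < M) (ha : |a| < M)
    (γ : ℝ → Kerr.region a M) (s : Set ℝ) (hs : s.OrdConnected) (hne : s.Nonempty)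
    (hγ : (Kerr.smoothMetric M a M).IsFutureTimelikeCurveOn
      ((Kerr.timeOrientation M a M hM0.le).ofLE le_top) γ s)
    (hL : ∀ t ∈ s, 0 < 3 * A - 2 * Kerr.radius a (γ t) - 3 * (γ t : E4) 0 ∧
      0 < 3 * A - 2 * Kerr.radius a (γ t) + 3 * (γ t : E4) 0 ∧
      0 < 2 * (γ t : E4) 0 + (Kerr.radius a (γ t) - M))
    (hend : ∀ q : Kerr.region a M, 0 < 3 * A - 2 * Kerr.radius a q - 3 * (q : E4) 0 →
      0 < 3 * A - 2 * Kerr.radius a q + 3 * (q : E4) 0 → 0 < 2 * (q : E4) 0 + (Kerr.radius a q - M) →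
      ¬ HasFutureEndpoint γ s q ∧ ¬ HasPastEndpoint γ s q) :
    ∃! t, t ∈ s ∧ (γ t : E4) 0 = 0 := by
  haveI : Nonempty s := hne.to_subtype
  have hβ := minkowski_curve hγ
  have hmono := strictMonoOn_time' hs hγ
  have hrM : ∀ σ, M < Kerr.radius a (γ σ) := fun σ => Kerr.lt_radius_of_mem_region (γ σ).2
  have hmem : ∀ q : E4, M < Kerr.radius a q → q ∈ Kerr.region a M := fun q hq => by
    rw [Kerr.mem_region, max_eq_left hM0.le]; exact hq
  -- uniqueness by monotonicity of `t*`; existence is what remains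
  suffices hex : ∃ t ∈ s, (γ t : E4) 0 = 0 by
    obtain ⟨t, ht, ht0⟩ := hex
    refine ⟨t, ⟨ht, ht0⟩, ?_⟩
    rintro t' ⟨ht', ht'0⟩
    exact hmono.injOn ht' ht (ht'0.trans ht0.symm)
  by_contra hno
  push Not at hno
  obtain ⟨t₀, ht₀⟩ := hne
  have hcont : ContinuousOn (fun σ => (γ σ : E4) 0) s := Minkowski.continuousOn_time hβ
  have hcr : Continuous fun q : E4 => Kerr.radius a q := Kerr.continuous_radius a
  have hc0 : Continuous fun q : E4 => q 0 := PiLp.continuous_apply 2 _ 0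
  -- the clocks along the curve
  have hw₁ := strictMonoOn_clock (c := 2 / 3) (by rw [abs_of_pos (by norm_num)]) ha hs hγ
  have hw₂ := strictMonoOn_clock (c := -(2 / 3)) (by rw [abs_neg, abs_of_pos (by norm_num)]) ha hs hγ
  have hf₃ := strictMonoOn_clock (c := 1 / 2) (by rw [abs_of_pos (by norm_num)]; norm_num) ha hs hγ
  obtain ⟨hL1, hL2, hL3⟩ := hL t₀ ht₀
  rcases lt_or_gt_of_ne (hno t₀ ht₀) with hneg | hpos
  · /- below the slice: futureward escape.  `t* < 0` on `s`, bounded above, so the coordinate curve has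
      a future endpoint `q` in `E4`; the clocks `t* − (2/3) r`, `t* + r/2` (increasing) and `t* ≤ 0`
      put `q` in the lens: contradiction. -/
    have hall : ∀ t ∈ s, (γ t : E4) 0 < 0 := by
      intro t ht
      by_contra hge
      push Not at hge
      obtain ⟨c, hc, hc0'⟩ := hs.isPreconnected.intermediate_value ht₀ ht hcont ⟨hneg.le, hge⟩
      exact hno c hc hc0'
    have hbdd : BddAbove ((fun σ => (γ σ : E4) 0) '' s) :=
      ⟨0, by rintro _ ⟨σ, hσ, rfl⟩; exact (hall σ hσ).le⟩
    obtain ⟨q, hq⟩ : ∃ q : E4, HasFutureEndpoint (fun σ => (γ σ : E4)) s q := by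
      by_contra hcon
      push Not at hcon
      exact Minkowski.not_bddAbove_time hs hβ ⟨⟨t₀, ht₀⟩, hcon⟩ hbdd
    have hqr : Tendsto (fun σ : s => Kerr.radius a (γ σ)) atTop (𝓝 (Kerr.radius a q)) :=
      (hcr.tendsto q).comp hq
    have hq0 : Tendsto (fun σ : s => (γ σ : E4) 0) atTop (𝓝 (q 0)) := (hc0.tendsto q).comp hq
    have hq0le : q 0 ≤ 0 := le_of_tendsto' hq0 fun σ => (hall σ σ.2).le
    have h2 : (γ t₀ : E4) 0 + -(2 / 3) * Kerr.radius a (γ t₀) ≤ q 0 + -(2 / 3) * Kerr.radius a q := by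
      refine ge_of_tendsto (hq0.add (hqr.const_mul (-(2 / 3)))) ?_
      filter_upwards [eventually_ge_atTop (⟨t₀, ht₀⟩ : s)] with σ hσ
      exact hw₂.monotoneOn ht₀ σ.2 hσ
    have h3 : (γ t₀ : E4) 0 + 1 / 2 * Kerr.radius a (γ t₀) ≤ q 0 + 1 / 2 * Kerr.radius a q := by
      refine ge_of_tendsto (hq0.add (hqr.const_mul (1 / 2))) ?_
      filter_upwards [eventually_ge_atTop (⟨t₀, ht₀⟩ : s)] with σ hσ
      exact hf₃.monotoneOn ht₀ σ.2 hσ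
    have hrq : M < Kerr.radius a q := by linarith
    exact (hend ⟨q, hmem q hrq⟩ (by simp only; linarith) (by simp only; linarith)
      (by simp only; linarith)).1 ((hasFutureEndpoint_subtypeVal_comp_iff (p := ⟨q, hmem q hrq⟩)).1 hq)
  · /- above the slice: pastward escape.  `t* > 0` on `s`, bounded below, so the coordinate curve has a
      past endpoint `q`; the clock `t* + (2/3) r` bounds the first two lens functions at `q` from below,
      and `r(q) > M` (the hole clock excludes `r(q) = M`), so `q` is in the lens: contradiction. -/
    have hall : ∀ t ∈ s, 0 < (γ t : E4) 0 := by
      intro t ht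
      by_contra hle
      push Not at hle
      obtain ⟨c, hc, hc0'⟩ := hs.isPreconnected.intermediate_value ht ht₀ hcont ⟨hle, hpos.le⟩
      exact hno c hc hc0'
    have hbdd : BddBelow ((fun σ => (γ σ : E4) 0) '' s) :=
      ⟨0, by rintro _ ⟨σ, hσ, rfl⟩; exact (hall σ hσ).le⟩
    obtain ⟨q, hq⟩ : ∃ q : E4, HasPastEndpoint (fun σ => (γ σ : E4)) s q := by
      by_contra hcon
      push Not at hcon
      exact Minkowski.not_bddBelow_time hs hβ ⟨⟨t₀, ht₀⟩, hcon⟩ hbdd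
    have hqr : Tendsto (fun σ : s => Kerr.radius a (γ σ)) atBot (𝓝 (Kerr.radius a q)) :=
      (hcr.tendsto q).comp hq
    have hq0 : Tendsto (fun σ : s => (γ σ : E4) 0) atBot (𝓝 (q 0)) := (hc0.tendsto q).comp hq
    have hq0ge : 0 ≤ q 0 := ge_of_tendsto' hq0 fun σ => (hall σ σ.2).le
    have h1 : q 0 + 2 / 3 * Kerr.radius a q ≤ (γ t₀ : E4) 0 + 2 / 3 * Kerr.radius a (γ t₀) := by
      refine le_of_tendsto (hq0.add (hqr.const_mul (2 / 3))) ?_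
      filter_upwards [eventually_le_atBot (⟨t₀, ht₀⟩ : s)] with σ hσ
      exact hw₁.monotoneOn σ.2 ht₀ hσ
    have hrqM : M ≤ Kerr.radius a q := ge_of_tendsto' hqr fun σ => (hrM σ).le
    rcases hrqM.lt_or_eq with hrq | hrq
    · exact (hend ⟨q, hmem q hrq⟩ (by simp only; linarith) (by simp only; linarith)
        (by simp only; linarith)).2 ((hasPastEndpoint_subtypeVal_comp_iff (p := ⟨q, hmem q hrq⟩)).1 hq)
    · have hev : ∀ᶠ σ : s in atBot, Kerr.radius a (γ σ) < Kerr.rPlus M a :=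
        hqr.eventually (Iio_mem_nhds (by rw [← hrq]; exact self_lt_rPlus ha))
      obtain ⟨σ₁, hσ₁⟩ := hev.exists_forall_of_atBot
      have hanti := strictAntiOn_radius ha (rMinus_lt_self ha) (hs.inter ordConnected_Iic)
        inter_subset_left hγ (s' := s ∩ Iic (σ₁ : ℝ)) (fun σ hσ => hσ₁ ⟨σ, hσ.1⟩ hσ.2)
      have hge : ∀ᶠ σ : s in atBot, Kerr.radius a (γ σ₁) ≤ Kerr.radius a (γ σ) := by
        filter_upwards [eventually_le_atBot σ₁] with σ hσ
        exact hanti.antitoneOn ⟨σ.2, hσ⟩ ⟨σ₁.2, self_mem_Iic⟩ hσ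
      have hle := ge_of_tendsto hqr hge
      linarith [hrM σ₁]

variable {M a : ℝ} (A : ℝ) (hM0 : 0 < M) (ha : |a| < M)
  (U : Opens (Kerr.spacetime M a M hM0.le).carrier)
  (hU : ∀ y : Kerr.region a M, y ∈ U ↔ 0 < 3 * A - 2 * Kerr.radius a y.1 - 3 * y.1 0 ∧
    0 < 3 * A - 2 * Kerr.radius a y.1 + 3 * y.1 0 ∧ 0 < 2 * y.1 0 + (Kerr.radius a y.1 - M))
include ha hU

/-- **The slice `{t* = 0}` is a Cauchy hypersurface of the lens `U_A`** (packaged form: every endless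
timelike curve of the open sub-spacetime `U_A` of `Kerr.spacetime M a M` meets `val⁻¹' {t* = 0}`
exactly once).  The lens enters as an abstract open set with its membership predicate.
[cite: ONeill1983, Ch. 14, Def. 14.28] -/
theorem isCauchyHypersurface_lens :
    ((Kerr.spacetime M a M hM0.le).metric.restrict PseudoRiemannianMetric.contMDiff_restrict_holds
        U).IsCauchyHypersurface
      ((Kerr.spacetime M a M hM0.le).timeOrientation.restrict
        PseudoRiemannianMetric.contMDiff_restrict_holds
        (Kerr.spacetime M a M hM0.le).timeOrientation.contMDiff_restrict_holds U)
      (Subtype.val ⁻¹' {y : Kerr.region a M | y.1 0 = 0}) := by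
  intro γ s hγ
  obtain ⟨hs, htl, hfe, hpe⟩ := hγ
  have htl' := (LorentzianMetric.isFutureTimelikeCurveOn_restrict_iff _ _ _ _ _).1 htl
  obtain ⟨t, ⟨hts, ht⟩, huniq⟩ := lens_cauchy_chart A hM0 ha (Subtype.val ∘ γ) s hs hfe.1 htl'
    (fun t _ => (hU _).1 (γ t).2)
    (fun q h1 h2 h3 => ⟨fun h => hfe.2 ⟨q, (hU q).2 ⟨h1, h2, h3⟩⟩ (hasFutureEndpoint_subtypeVal_comp_iff.1 h),
      fun h => hpe.2 ⟨q, (hU q).2 ⟨h1, h2, h3⟩⟩ (hasPastEndpoint_subtypeVal_comp_iff.1 h)⟩)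
  exact ⟨t, ⟨hts, ht⟩, fun t' ht' => huniq t' ⟨ht'.1, ht'.2⟩⟩

/-- **The lens `U_A` is globally hyperbolic** (a spacetime with a Cauchy hypersurface is globally
hyperbolic: `IsCauchyHypersurface.isGloballyHyperbolic`, O'Neill's Cor. 14.39, in the tree).
[cite: ONeill1983, Ch. 14, Cor. 14.39] -/
theorem isGloballyHyperbolic_lens :
    ((Kerr.spacetime M a M hM0.le).metric.restrict PseudoRiemannianMetric.contMDiff_restrict_holds
        U).IsGloballyHyperbolic
      ((Kerr.spacetime M a M hM0.le).timeOrientation.restrict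
        PseudoRiemannianMetric.contMDiff_restrict_holds
        (Kerr.spacetime M a M hM0.le).timeOrientation.contMDiff_restrict_holds U) := by
  -- the Levi-Civita instances of the (smooth) restricted metric, consumed by the limit-curve machinery
  haveI : Fact ((1 : ℕ∞ω) ≤ ∞) := ⟨by exact_mod_cast le_top⟩
  haveI : ((Kerr.spacetime M a M hM0.le).metric.restrict PseudoRiemannianMetric.contMDiff_restrict_holds
      U).HasLeviCivita := PseudoRiemannianMetric.hasLeviCivita _
  haveI : CovariantDerivative.ContMDiffCovariantDerivative
      ((Kerr.spacetime M a M hM0.le).metric.restrict PseudoRiemannianMetric.contMDiff_restrict_holds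
        U).leviCivita 1 :=
    ⟨((Kerr.spacetime M a M hM0.le).metric.restrict PseudoRiemannianMetric.contMDiff_restrict_holds
        U).toPseudoRiemannianMetric.isLocallyContMDiff_leviCivita_holds 1
      (by rw [show ((1 : ℕ∞) : ℕ∞ω) + 1 = 2 by norm_num]; exact WithTop.coe_le_coe.2 le_top)
      univ isOpen_univ⟩
  exact (isCauchyHypersurface_lens A hM0 ha U hU).isGloballyHyperbolic le_rfl

/-- **In the lens `U_A`, the causal future of a compact set is closed** (causal simplicity of globally
hyperbolic spacetimes: `IsGloballyHyperbolic.isClosed_causalFuture_of_isCompact`, O'Neill's Lemma 14.22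
with Ex. 14.4 (b), in the tree). [cite: ONeill1983, Ch. 14, Lemma 14.22] -/
theorem isClosed_causalFuture_lens {K : Set U} (hK : IsCompact K) :
    IsClosed (((Kerr.spacetime M a M hM0.le).metric.restrict
        PseudoRiemannianMetric.contMDiff_restrict_holds U).causalFuture
      ((Kerr.spacetime M a M hM0.le).timeOrientation.restrict
        PseudoRiemannianMetric.contMDiff_restrict_holds
        (Kerr.spacetime M a M hM0.le).timeOrientation.contMDiff_restrict_holds U) K) :=
  (isGloballyHyperbolic_lens A hM0 ha U hU).isClosed_causalFuture_of_isCompact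
    (WithTop.coe_le_coe.mpr le_top) hK

end KerrLens

/-- **Registered bookkeeping sub-goal `stub_kerrLensGloballyHyperbolic` of the line** (brick of the
landing of K2b-2 `stub_slabFrontier`): for every `A`, the lens
`U_A = {3A − 2r − 3t* > 0} ∩ {3A − 2r + 3t* > 0} ∩ {2t* + r − M > 0}` of the Kerr star chart `{r > M}`
(`0 < M`, `|a| < M`), given as an open set with its membership predicate, is a globally hyperbolic open
sub-spacetime (`KerrLens.isGloballyHyperbolic_lens`: its slice `{t* = 0}` is a Cauchy hypersurface).
[cite: ONeill1983, Ch. 14, Cor. 14.39] -/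
theorem stub_kerrLensGloballyHyperbolic : ∀ [Kerr.Facts] (M a A : ℝ) (hM : 0 < M), |a| < M →
    ∀ U : TopologicalSpace.Opens (Kerr.spacetime M a M hM.le).carrier,
      (∀ y : Kerr.region a M, y ∈ U ↔ 0 < 3 * A - 2 * Kerr.radius a y.1 - 3 * y.1 0 ∧
        0 < 3 * A - 2 * Kerr.radius a y.1 + 3 * y.1 0 ∧ 0 < 2 * y.1 0 + (Kerr.radius a y.1 - M)) →
      ((Kerr.spacetime M a M hM.le).metric.restrict PseudoRiemannianMetric.contMDiff_restrict_holds
          U).IsGloballyHyperbolic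
        ((Kerr.spacetime M a M hM.le).timeOrientation.restrict
          PseudoRiemannianMetric.contMDiff_restrict_holds
          (Kerr.spacetime M a M hM.le).timeOrientation.contMDiff_restrict_holds U) :=
  fun _ _ A hM ha U hU => KerrLens.isGloballyHyperbolic_lens A hM ha U hU

end Summit.FinalStateConjecture.FinalStateConjecture.Theorems.BondiBartnikRigidity.DirectMethod

end
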